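import Literature.NumberTheory.EllipticCurves.ZpExtensionEisensteinSelmerStructure
import Literature.NumberTheory.EllipticCurves.ZpExtensionEisensteinH1Limit
import Literature.NumberTheory.GaloisRepresentations.GaloisCohomologyScalarActionLocalConditions
import Literature.NumberTheory.GaloisCohomology.Howard2004.SelmerTriples
import HarnessLib

/-!
# Howard's `F_𝔮` is a Selmer structure of `A_{m,k}`-modules, `H¹_{F_𝔮}(K, T_𝔮)` is a `Λ`-submodule, and `F_𝔮` is a
# Howard Selmer structure for `Σ = ∞ ∪ S'` (theorems only; no definition, no named fact, no instance)

Topic `NumberTheory/EllipticCurves` (D1 road of cell `pub/bsd-print-x9`; companion of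
`ZpExtensionEisensteinSelmerStructure`). With the notation of that file (`W_k = M_k ⊗ A_{m,k}(ψ)`,
`F_𝔮 = ZpExtension.eisensteinSelmerStructure κ ρ t hm S Φ k`):

* §1 `galoisCohomology.map_scalarMapH1_of_semilinear` — `H¹(f) ∘ H¹(r•) = H¹(r'•) ∘ H¹(f)` for a continuous
  equivariant `f` with `f (r • m) = r' • f m` (two coefficient rings; the tree's `map_scalarMapH1` is `r = r'`);
  `DiscreteGaloisModule.scalarMapH1_mem_strictSubgroup` — the STRICT condition `ker (H¹(F, W) → H¹(F, W/W⁺))` is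
  stable under `H¹(r•)` as soon as `W⁺` is `r`-stable (the scalar descends to an equivariant endomorphism of
  `W/W⁺`); `Tower.map_mem_levelCondition` — the level conditions of a saturated tower are stable under any
  reduction-compatible system of additive endomorphisms preserving the cores.
* §2 `ZpExtension.isScalarStable_eisensteinSelmerStructure` — **`F_𝔮` at level `k` is stable under the coefficient
  action of `A_{m,k}`** (`SelmerStructure.IsScalarStable`, Howard Def. 1.1.1: local conditions are `R`-submodules):
  place by place, `⊤`; the saturated towers via the system `(H¹([g]_j •))_j`, `g ∈ Λ` a lift of the scalar
  (`eisensteinLocalReduce_scalarMapH1`: the local reductions are semilinear; ordinary cores stable because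
  `A_{m,k} ⊗ Fil_v M_k` is an `A_{m,k}`-submodule; unramified cores by the tree's
  `scalarMapH1_mem_unramifiedSubgroup`); the unramified condition likewise. Hence
  `ZpExtension.map_eisensteinTwistSMulHom_mem_selmerGroup` (the hypothesis `h𝓕` of
  `EisensteinH1Data.selmerSubmodule`) and **`EisensteinH1Data.ordinarySelmer_smul_mem`**: Howard's
  `H¹_{F_𝔮}(K, T_𝔮) = EisensteinH1Data.ordinarySelmer` is a `Λ`-SUBMODULE of the pinned `H¹(K, T_𝔮)`
  (`= (D.selmerSubmodule F_𝔮 _).toAddSubgroup`, `ordinarySelmer_eq_toAddSubgroup_selmerSubmodule`).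
* §2b `ZpExtension.eisensteinLocalReduce_mem_eisensteinSelmerStructure` — `F_𝔮` is a COMPATIBLE family along the
  tower (local reductions map `F_𝔮` at level `k+1` into level `k`; `Tower.red_mem_levelCondition`,
  `DiscreteGaloisModule.map_mem_unramifiedSubgroup`) — the shape of `Howard2004.AdicTower.IsCompatibleFamily`.
* §3 `ZpExtension.isUnramifiedOutside_eisensteinSelmerStructure` / `isHowardSelmerStructure_eisensteinSelmerStructure`
  — for any finite set `S'` of finite places containing `S`, the places above `p` and the places where `W_k` is
  ramified, `F_𝔮` at level `k` is a Selmer structure in Howard's sense (Def. 1.1.10 / tree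
  `Howard2004.IsHowardSelmerStructure`) for `Σ = ∞ ∪ S'` — BY CONSTRUCTION (outside `S ∪ {v ∣ p}` the condition IS
  the unramified one).

Theorems only; nothing asserted about any curve, Selmer group or `L`-function; no `sorry`. BSD is not proved by any
of this.

References: [Howard2004HeegnerKolyvagin] B. Howard, Compositio Math. 140 (2004) — arXiv 1202.6340 Def. 2.1.1 (local
conditions are `R`-submodules; propagation), Def. 2.1.10 (Selmer structures, `Σ(F)`), Def. 3.1.2, §3.1;
[MazurRubinMemoirs2004] Def. 1.1.1, Def. 2.1.1; [SerreGaloisCohomology1997] I §2.2, §2.4, §5.1.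
-/

noncomputable section

open scoped TensorProduct Topology ContRepresentation
open Field Filter IsDedekindDomain

universe u

namespace Literature.NumberTheory.EllipticCurves

open Literature.NumberTheory.GaloisRepresentations
open Literature.NumberTheory.GaloisRepresentations.DiscreteGaloisModule (SelmerStructure)
open scoped NumberField

/-! ## §1 Generic pieces -/

namespace DiscreteGaloisModule

variable {F : Type u} [Field F] {M N : Type u} [AddCommGroup M] [TopologicalSpace M] [DiscreteTopology M]
  [AddCommGroup N] [TopologicalSpace N] [DiscreteTopology N]
  {ρ : DiscreteGaloisModule F M} {ρ' : DiscreteGaloisModule F N}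

/-- **Change of module commutes with SEMILINEAR scalar actions** (degree `1`): for a continuous equivariant `f`
with `f (r • m) = r' • f m` (`r ∈ R` acting on `M`, `r' ∈ R'` on `N`), `H¹(f) (H¹(r•) x) = H¹(r'•) (H¹(f) x)` —
both are the class of `σ ↦ f (r • φ σ) = r' • f (φ σ)`. (The tree's `galoisCohomology.map_scalarMapH1` is the case
`R = R'`, `r = r'`.) [cite: SerreGaloisCohomology1997, Ch. I §2.4 (compatible pairs) and §5.1] -/
theorem map_scalarMapH1_of_semilinear {R R' : Type*} [Ring R] [Ring R'] [Module R M] [Module R' N]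
    (hρ : ρ.IsScalarLinear R) (hρ' : ρ'.IsScalarLinear R')
    (f : ρ.toContRepresentation →ⁱL ρ'.toContRepresentation) {r : R} {r' : R'}
    (hf : ∀ m : M, f (r • m) = r' • f m) (x : galoisCohomology ρ 1) :
    galoisCohomology.map f 1 (galoisCohomology.scalarMapH1 ρ hρ r x) =
      galoisCohomology.scalarMapH1 ρ' hρ' r' (galoisCohomology.map f 1 x) := by
  obtain ⟨φ, rfl⟩ := oneCocycleClass_surjective ρ.toTopRep x
  rw [galoisCohomology.scalarMapH1_oneCocycleClass]
  change ContinuousCohomology.map _ _ 1 _ =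
    galoisCohomology.scalarMapH1 ρ' hρ' r' (ContinuousCohomology.map _ _ 1 _)
  rw [map_oneCocycleClass, map_oneCocycleClass, galoisCohomology.scalarMapH1_oneCocycleClass]
  exact congrArg _ (Subtype.ext (ContinuousMap.ext fun σ ↦ hf (φ.1 σ)))

/-- **The strict condition is an `R`-submodule when `W⁺` is `r`-stable**: `ker (H¹(F, W) → H¹(F, W/W⁺))`
(`DiscreteGaloisModule.strictSubgroup`) is stable under `H¹(r•)` — the scalar `r` descends to an equivariant
endomorphism `r̄` of `W/W⁺` (`Submodule.mapQ`) with `H¹(W → W/W⁺) ∘ H¹(r•) = H¹(r̄) ∘ H¹(W → W/W⁺)`.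
[cite: Howard2004HeegnerKolyvagin, Def. 1.1.1 (arXiv Def. 2.1.1: local conditions are R-submodules) and §3.1 (H¹_ord)]
[cite: SerreGaloisCohomology1997, Ch. I §2.4] -/
theorem scalarMapH1_mem_strictSubgroup {R : Type*} [Ring R] [Module R M] (hρ : ρ.IsScalarLinear R)
    (Wp : Submodule ℤ M) (h : ∀ σ : absoluteGaloisGroup F, Wp ≤ Wp.comap (ρ σ)) (r : R)
    (hr : ∀ w ∈ Wp, r • w ∈ Wp) {x : galoisCohomology ρ 1}
    (hx : x ∈ DiscreteGaloisModule.strictSubgroup ρ Wp h) :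
    galoisCohomology.scalarMapH1 ρ hρ r x ∈ DiscreteGaloisModule.strictSubgroup ρ Wp h := by
  -- the descended endomorphism `r̄` of `W/W⁺`
  let rlin : M →ₗ[ℤ] M := (DistribSMul.toAddMonoidHom M r).toIntLinearMap
  have hrlin : Wp ≤ Wp.comap rlin := fun w hw ↦ hr w hw
  let rbar : (ρ.quotient Wp h).toContRepresentation →ⁱL (ρ.quotient Wp h).toContRepresentation :=
    { toContinuousLinearMap := ⟨Wp.mapQ Wp rlin hrlin, continuous_of_discreteTopology⟩
      isIntertwining' := fun σ ↦ by
        refine ContinuousLinearMap.ext fun q ↦ ?_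
        induction q using Submodule.Quotient.induction_on with
        | _ w =>
          change Wp.mapQ Wp rlin hrlin ((ρ.quotient Wp h) σ (Submodule.Quotient.mk w)) =
            (ρ.quotient Wp h) σ (Wp.mapQ Wp rlin hrlin (Submodule.Quotient.mk w))
          rw [ContinuousRep.quotient_apply_mk, Submodule.mapQ_apply, Submodule.mapQ_apply,
            ContinuousRep.quotient_apply_mk]
          exact congrArg _ (hρ σ r w).symm }
  -- naturality `H¹(mkQ) ∘ H¹(r•) = H¹(r̄) ∘ H¹(mkQ)` on cocycle classes
  have nat : ∀ y : galoisCohomology ρ 1,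
      DiscreteGaloisModule.quotientMap ρ Wp h 1 (galoisCohomology.scalarMapH1 ρ hρ r y) =
        galoisCohomology.map rbar 1 (DiscreteGaloisModule.quotientMap ρ Wp h 1 y) := by
    intro y
    obtain ⟨φ, rfl⟩ := oneCocycleClass_surjective ρ.toTopRep y
    rw [galoisCohomology.scalarMapH1_oneCocycleClass]
    change ContinuousCohomology.map _ _ 1 _ = ContinuousCohomology.map _ _ 1 (ContinuousCohomology.map _ _ 1 _)
    rw [map_oneCocycleClass, map_oneCocycleClass, map_oneCocycleClass]
    exact congrArg _ (Subtype.ext (ContinuousMap.ext fun σ ↦ rfl))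
  rw [DiscreteGaloisModule.mem_strictSubgroup_iff] at hx ⊢
  rw [nat, hx, map_zero]

/-- **Change of module preserves unramified classes**: for a valued field `F` and an equivariant `f : M → N`,
`H¹(f)` maps `H¹_ur(F, M) = ker (H¹(F, M) → H¹(F^{ur}, M))` into `H¹_ur(F, N)` (restriction to `F^{ur}` commutes with
`H¹(f)`, `pullback_map_one`). [cite: SerreGaloisCohomology1997, Ch. I §2.4 (compatible pairs)] [cite: Howard2004HeegnerKolyvagin, Lemma 1.1.5 (arXiv Lemma 2.1.5: the unramified condition is functorial)] -/
theorem map_mem_unramifiedSubgroup [ValuativeRel F] (f : ρ.toContRepresentation →ⁱL ρ'.toContRepresentation)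
    {x : galoisCohomology ρ 1} (hx : x ∈ DiscreteGaloisModule.unramifiedSubgroup ρ 1) :
    galoisCohomology.map f 1 x ∈ DiscreteGaloisModule.unramifiedSubgroup ρ' 1 := by
  rw [DiscreteGaloisModule.mem_unramifiedSubgroup_iff] at hx ⊢
  change galoisCohomology.pullback ρ' _ 1 (galoisCohomology.map f 1 x) = 0
  rw [pullback_map_one]
  change galoisCohomology.map _ 1 (galoisCohomology.res ρ _ 1 x) = 0
  rw [hx, map_zero]

end DiscreteGaloisModule

namespace Tower

variable {H : ℕ → Type u} [∀ j, AddCommGroup (H j)] (red : ∀ j, H (j + 1) →+ H j)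

/-- **Level conditions are stable under reduction-compatible core-preserving endomorphisms**: if additive maps
`e_j : H_j → H_j` commute with the reductions and preserve the cores, they map saturated families to saturated
families. [cite: Howard2004HeegnerKolyvagin, Def. 1.1.1 (arXiv Def. 2.1.1: local conditions are R-submodules; propagation)] -/
theorem map_mem_saturatedFamilies (p : ℕ) (C : ∀ j, AddSubgroup (H j)) (e : ∀ j, H j →+ H j)
    (hred : ∀ j (x : H (j + 1)), red j (e (j + 1) x) = e j (red j x))
    (hC : ∀ j (x : H j), x ∈ C j → e j x ∈ C j) {x : Π j, H j} (hx : x ∈ saturatedFamilies red p C) :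
    (fun j ↦ e j (x j)) ∈ saturatedFamilies red p C := by
  rw [mem_saturatedFamilies_iff] at hx ⊢
  obtain ⟨hxc, a, ha⟩ := hx
  refine ⟨fun j ↦ by rw [hred, hxc], a, fun j ↦ ?_⟩
  rw [← map_nsmul]
  exact hC j _ (ha j)

/-- Hence the level-`k` condition is stable under `e_k` whenever `e_k` is the `k`-th member of such a system.
[cite: Howard2004HeegnerKolyvagin, Def. 1.1.1 and Def. 2.1.3 (propagation along Quot(T))] -/
theorem map_mem_levelCondition (p : ℕ) (C : ∀ j, AddSubgroup (H j)) (e : ∀ j, H j →+ H j)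
    (hred : ∀ j (x : H (j + 1)), red j (e (j + 1) x) = e j (red j x))
    (hC : ∀ j (x : H j), x ∈ C j → e j x ∈ C j) {k : ℕ} {y : H k} (hy : y ∈ levelCondition red p C k) :
    e k y ∈ levelCondition red p C k := by
  rw [mem_levelCondition_iff] at hy ⊢
  obtain ⟨x, hx, rfl⟩ := hy
  exact ⟨fun j ↦ e j (x j), map_mem_saturatedFamilies red p C e hred hC hx, rfl⟩

/-- **The level conditions form a compatible family**: the reduction maps the level-`(k+1)` condition into the
level-`k` condition (a saturated family is, in particular, compatible).
[cite: Howard2004HeegnerKolyvagin, Def. 2.1.3 (arXiv: propagation along Quot(T)) and §1.6] -/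
theorem red_mem_levelCondition (p : ℕ) (C : ∀ j, AddSubgroup (H j)) {k : ℕ} {y : H (k + 1)}
    (hy : y ∈ levelCondition red p C (k + 1)) : red k y ∈ levelCondition red p C k := by
  rw [mem_levelCondition_iff] at hy
  obtain ⟨x, hx, rfl⟩ := hy
  rw [((mem_saturatedFamilies_iff red p C x).1 hx).1 k]
  exact apply_mem_levelCondition red p C hx k

end Tower

/-! ## §2 `F_𝔮` is stable under the coefficient action; `H¹_{F_𝔮}(K, T_𝔮)` is a `Λ`-submodule -/

namespace ZpExtension

variable {K : Type u} [Field K] [NumberField K] {p : ℕ} [hp : Fact p.Prime] (κ : ZpExtension K p)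
  {M : ℕ → Type u} [∀ k, AddCommGroup (M k)] [∀ k, TopologicalSpace (M k)] [∀ k, DiscreteTopology (M k)]
  (ρ : ∀ k, DiscreteGaloisModule K (M k))
  (t : ∀ k, (ρ (k + 1)).toContRepresentation →ⁱL (ρ k).toContRepresentation) {m : ℕ} (hm : 1 ≤ m)

/-- **The local reductions are semilinear**: `red_k (H¹([g]_{k+1} •) x) = H¹([g]_k •) (red_k x)` on
`H¹(K_v, W_{k+1}) → H¹(K_v, W_k)`, `g ∈ Λ` (`eisensteinTwistReduce_mk_smul` on cocycles).
[cite: Howard2004HeegnerKolyvagin, §2.2 (T_𝔮 is an S_𝔮[G_K]-module)] [cite: SerreGaloisCohomology1997, Ch. I §2.4] -/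
theorem eisensteinLocalReduce_scalarMapH1 (v : NumberField.Place K) (k : ℕ) (g : IwasawaAlgebra p)
    (x : galoisCohomology ((κ.eisensteinTwist (ρ (k + 1)) hm (k + 1)).toLocal v) 1) :
    κ.eisensteinLocalReduce ρ t hm v k
        (galoisCohomology.scalarMapH1 ((κ.eisensteinTwist (ρ (k + 1)) hm (k + 1)).toLocal v)
          ((κ.isScalarLinear_eisensteinTwist (ρ (k + 1)) hm (k + 1)).restrictField (NumberField.Place.Completion v))
          (Ideal.Quotient.mk _ g) x) =
      galoisCohomology.scalarMapH1 ((κ.eisensteinTwist (ρ k) hm k).toLocal v)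
        ((κ.isScalarLinear_eisensteinTwist (ρ k) hm k).restrictField (NumberField.Place.Completion v))
        (Ideal.Quotient.mk _ g) (κ.eisensteinLocalReduce ρ t hm v k x) :=
  DiscreteGaloisModule.map_scalarMapH1_of_semilinear _ _
    (DiscreteGaloisModule.localMap (κ.eisensteinTwistReduce hm (Nat.le_succ k) (t k)) v)
    (fun w ↦ κ.eisensteinTwistReduce_mk_smul hm (Nat.le_succ k) (t k) g w) x

/-- `eisensteinLocalReduce_scalarMapH1` at a finite place, in the spelling `GaloisRep.toLocal v` of the local
modules (definitionally the same statement). [cite: Howard2004HeegnerKolyvagin, §2.2] [cite: SerreGaloisCohomology1997, Ch. I §2.4] -/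
theorem eisensteinLocalReduce_scalarMapH1_inr (v : HeightOneSpectrum (𝓞 K)) (k : ℕ) (g : IwasawaAlgebra p)
    (x : galoisCohomology (GaloisRep.toLocal v (κ.eisensteinTwist (ρ (k + 1)) hm (k + 1))) 1) :
    κ.eisensteinLocalReduce ρ t hm (Sum.inr v) k
        (galoisCohomology.scalarMapH1 (GaloisRep.toLocal v (κ.eisensteinTwist (ρ (k + 1)) hm (k + 1)))
          ((κ.isScalarLinear_eisensteinTwist (ρ (k + 1)) hm (k + 1)).restrictField (v.adicCompletion K))
          (Ideal.Quotient.mk _ g) x) =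
      galoisCohomology.scalarMapH1 (GaloisRep.toLocal v (κ.eisensteinTwist (ρ k) hm k))
        ((κ.isScalarLinear_eisensteinTwist (ρ k) hm k).restrictField (v.adicCompletion K))
        (Ideal.Quotient.mk _ g) (κ.eisensteinLocalReduce ρ t hm (Sum.inr v) k x) :=
  κ.eisensteinLocalReduce_scalarMapH1 ρ t hm (Sum.inr v) k g x

section Cores

variable {κ ρ t} {v : HeightOneSpectrum (𝓞 K)} (Φ : OrdinaryFiltration ρ t v)

/-- The twisted plus part `A_{m,k} ⊗ Fil_v M_k` is an `A_{m,k}`-submodule of `W_k` (`c' • (c ⊗ a) = (c' c) ⊗ a`).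
[cite: Howard2004HeegnerKolyvagin, §3.1 (Fil_v T_𝔮 = Fil_v T ⊗ S_𝔮 is an S_𝔮-submodule)] -/
theorem OrdinaryFiltration.smul_mem_twistedFil (k : ℕ) (c : IwasawaAlgebra.EisensteinCoeff p m k)
    {x : IwasawaAlgebra.EisensteinCoeff.Twisted p m k (M k)} (hx : x ∈ Φ.twistedFil k) :
    c • x ∈ Φ.twistedFil k := by
  induction hx using Submodule.span_induction with
  | mem y hy =>
    obtain ⟨c', a, ha, rfl⟩ := hy
    rw [IwasawaAlgebra.EisensteinCoeff.Twisted.smul_tmul]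
    exact Φ.tmul_mem_twistedFil k _ ha
  | zero => rw [smul_zero]; exact zero_mem _
  | add y z _ _ hy hz => rw [smul_add]; exact add_mem hy hz
  | smul n y _ hy => rw [smul_comm]; exact Submodule.smul_mem _ n hy

/-- **The ordinary cores are `A_{m,k}`-submodules**: the strict condition at `v ∣ p` is stable under the local scalar
action `H¹(c •)`. [cite: Howard2004HeegnerKolyvagin, Def. 1.1.1 and §3.1 (H¹_ord is an S_𝔮-submodule)] -/
theorem OrdinaryFiltration.scalarMapH1_mem_ordinaryCore (k : ℕ) (c : IwasawaAlgebra.EisensteinCoeff p m k)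
    {x : galoisCohomology (GaloisRep.toLocal v (κ.eisensteinTwist (ρ k) hm k)) 1} (hx : x ∈ Φ.ordinaryCore hm k) :
    galoisCohomology.scalarMapH1 (GaloisRep.toLocal v (κ.eisensteinTwist (ρ k) hm k))
        ((κ.isScalarLinear_eisensteinTwist (ρ k) hm k).restrictField (v.adicCompletion K)) c x ∈
      Φ.ordinaryCore hm k :=
  DiscreteGaloisModule.scalarMapH1_mem_strictSubgroup _ _ _ c (fun _ hw ↦ Φ.smul_mem_twistedFil k c hw) hx

end Cores

variable (S : Finset (HeightOneSpectrum (𝓞 K)))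
  (Φ : ∀ v : HeightOneSpectrum (𝓞 K), ((p : ℕ) : 𝓞 K) ∈ v.asIdeal → OrdinaryFiltration ρ t v)

/-- **`F_𝔮` is a Selmer structure of `A_{m,k}`-modules** (Howard: «a local condition … is a choice of `R`-submodule
of `H¹(K_v, T)`»): at every place the level-`k` condition is stable under the local scalar action `H¹(c •)`,
`c ∈ A_{m,k}` (tree `SelmerStructure.IsScalarStable`). Proof: `⊤`; the saturated towers are stable under the
reduction-compatible system `(H¹([g]_j •))_j`, `g ∈ Λ` a lift of `c`, which preserves the ordinary cores
(`A_{m,j} ⊗ Fil_v M_j` is a submodule) and the unramified cores; the unramified condition is stable.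
[cite: Howard2004HeegnerKolyvagin, Def. 1.1.1 (arXiv Def. 2.1.1) and Def. 3.1.2] [cite: MazurRubinMemoirs2004, Def. 2.1.1] -/
theorem isScalarStable_eisensteinSelmerStructure (k : ℕ) :
    (κ.eisensteinSelmerStructure ρ t hm S Φ k).IsScalarStable (κ.isScalarLinear_eisensteinTwist (ρ k) hm k) := by
  classical
  rw [DiscreteGaloisModule.SelmerStructure.isScalarStable_iff]
  intro v c x hx
  obtain ⟨g, rfl⟩ := Ideal.Quotient.mk_surjective c
  rcases v with w | v
  · rw [eisensteinSelmerStructure_inl] at hx ⊢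
    exact AddSubgroup.mem_top _
  · by_cases hv : ((p : ℕ) : 𝓞 K) ∈ v.asIdeal
    · rw [κ.eisensteinSelmerStructure_inr_of_mem ρ t hm S Φ k hv] at hx ⊢
      exact Tower.map_mem_levelCondition _ p _
        (fun j ↦ galoisCohomology.scalarMapH1 (GaloisRep.toLocal v (κ.eisensteinTwist (ρ j) hm j))
          ((κ.isScalarLinear_eisensteinTwist (ρ j) hm j).restrictField (v.adicCompletion K))
          (Ideal.Quotient.mk _ g))
        (fun j y ↦ κ.eisensteinLocalReduce_scalarMapH1_inr ρ t hm v j g y)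
        (fun j y hy ↦ (Φ v hv).scalarMapH1_mem_ordinaryCore hm j _ hy) hx
    · by_cases hvS : v ∈ S
      · rw [κ.eisensteinSelmerStructure_inr_of_mem_of_not_mem ρ t hm S Φ k hv hvS] at hx ⊢
        exact Tower.map_mem_levelCondition _ p _
          (fun j ↦ galoisCohomology.scalarMapH1 (GaloisRep.toLocal v (κ.eisensteinTwist (ρ j) hm j))
            ((κ.isScalarLinear_eisensteinTwist (ρ j) hm j).restrictField (v.adicCompletion K))
            (Ideal.Quotient.mk _ g))
          (fun j y ↦ κ.eisensteinLocalReduce_scalarMapH1_inr ρ t hm v j g y)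
          (fun j y hy ↦ DiscreteGaloisModule.scalarMapH1_mem_unramifiedSubgroup
            ((κ.isScalarLinear_eisensteinTwist (ρ j) hm j).restrictField (v.adicCompletion K)) _ hy) hx
      · rw [κ.eisensteinSelmerStructure_inr_of_not_mem ρ t hm S Φ k hv hvS] at hx ⊢
        exact DiscreteGaloisModule.scalarMapH1_mem_unramifiedSubgroup
          ((κ.isScalarLinear_eisensteinTwist (ρ k) hm k).restrictField (v.adicCompletion K)) _ hx

/-- **The coefficient action preserves `F_𝔮`-Selmer classes**: `H¹(c •)` (`galoisCohomology.map` of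
`eisensteinTwistSMulHom … c`) maps `H¹_{F_𝔮}(K, W_k)` into itself — the hypothesis `h𝓕` of
`EisensteinH1Data.selmerSubmodule` for the family `F_𝔮`. [cite: Howard2004HeegnerKolyvagin, Def. 1.1.10 (arXiv Def. 2.1.10: the Selmer module H¹_F(K,T) is an R-module)] -/
theorem map_eisensteinTwistSMulHom_mem_selmerGroup (k : ℕ) (c : IwasawaAlgebra.EisensteinCoeff p m k)
    (x : galoisCohomology (κ.eisensteinTwist (ρ k) hm k) 1)
    (hx : x ∈ (κ.eisensteinSelmerStructure ρ t hm S Φ k).selmerGroup) :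
    galoisCohomology.map (κ.eisensteinTwistSMulHom (ρ k) hm k c) 1 x ∈
      (κ.eisensteinSelmerStructure ρ t hm S Φ k).selmerGroup := by
  rw [← κ.scalarMapH1_eisensteinTwist_eq (ρ k) hm k c]
  exact DiscreteGaloisModule.SelmerStructure.scalarMapH1_mem_selmerGroup _
    (κ.isScalarStable_eisensteinSelmerStructure ρ t hm S Φ k) c hx

/-- **`F_𝔮` is a compatible family along the tower**: at every place `v` the local reduction
`H¹(K_v, W_{k+1}) → H¹(K_v, W_k)` maps `F_𝔮` at level `k+1` into `F_𝔮` at level `k` (the saturated towers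
consist of compatible families; the unramified condition is functorial). This is the shape
`Howard2004.AdicTower.IsCompatibleFamily` asks of a Selmer structure on a compact module seen on its levels.
[cite: Howard2004HeegnerKolyvagin, §1.6 (arXiv p. 12: Selmer structures on T seen on T/𝔪^k) and Def. 2.1.3] -/
theorem eisensteinLocalReduce_mem_eisensteinSelmerStructure (k : ℕ) (v : NumberField.Place K)
    {y : galoisCohomology ((κ.eisensteinTwist (ρ (k + 1)) hm (k + 1)).toLocal v) 1}
    (hy : y ∈ κ.eisensteinSelmerStructure ρ t hm S Φ (k + 1) v) :
    κ.eisensteinLocalReduce ρ t hm v k y ∈ κ.eisensteinSelmerStructure ρ t hm S Φ k v := by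
  classical
  rcases v with w | v
  · rw [eisensteinSelmerStructure_inl]
    exact AddSubgroup.mem_top _
  · by_cases hv : ((p : ℕ) : 𝓞 K) ∈ v.asIdeal
    · rw [κ.eisensteinSelmerStructure_inr_of_mem ρ t hm S Φ _ hv] at hy ⊢
      exact Tower.red_mem_levelCondition _ p _ hy
    · by_cases hvS : v ∈ S
      · rw [κ.eisensteinSelmerStructure_inr_of_mem_of_not_mem ρ t hm S Φ _ hv hvS] at hy ⊢
        exact Tower.red_mem_levelCondition _ p _ hy
      · rw [κ.eisensteinSelmerStructure_inr_of_not_mem ρ t hm S Φ _ hv hvS] at hy ⊢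
        exact DiscreteGaloisModule.map_mem_unramifiedSubgroup
          (ρ := GaloisRep.toLocal v (κ.eisensteinTwist (ρ (k + 1)) hm (k + 1)))
          (ρ' := GaloisRep.toLocal v (κ.eisensteinTwist (ρ k) hm k)) _ hy

namespace EisensteinH1Data

variable {κ ρ t hm} (D : EisensteinH1Data κ ρ t hm)

/-- **`H¹_{F_𝔮}(K, T_𝔮)` is a `Λ`-submodule of the pinned `H¹(K, T_𝔮)`**: `EisensteinH1Data.ordinarySelmer` is
stable under the `Λ`-action (`proj_smul` + `map_eisensteinTwistSMulHom_mem_selmerGroup`).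
[cite: Howard2004HeegnerKolyvagin, Def. 3.1.2 and Prop. 3.1.3 (H¹_{F_𝔮}(K, T_𝔮) is an S_𝔮-module)] -/
theorem ordinarySelmer_smul_mem (f : IwasawaAlgebra p) {h : D.H} (hh : h ∈ D.ordinarySelmer S Φ) :
    f • h ∈ D.ordinarySelmer S Φ := by
  rw [mem_ordinarySelmer_iff] at hh ⊢
  intro k
  rw [D.proj_smul]
  exact κ.map_eisensteinTwistSMulHom_mem_selmerGroup ρ t hm S Φ k _ _ (hh k)

/-- `ordinarySelmer` is the underlying subgroup of the `Λ`-submodule `D.selmerSubmodule F_𝔮 _` (the tree's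
packaging of a scalar-stable Selmer family), so consumers may use either. [cite: Howard2004HeegnerKolyvagin, Def. 3.1.2 and Prop. 3.1.3] -/
theorem ordinarySelmer_eq_toAddSubgroup_selmerSubmodule :
    D.ordinarySelmer S Φ =
      (D.selmerSubmodule (κ.eisensteinSelmerStructure ρ t hm S Φ)
        (fun k c x hx ↦ κ.map_eisensteinTwistSMulHom_mem_selmerGroup ρ t hm S Φ k c x hx)).toAddSubgroup :=
  rfl

/-- Membership in the `Λ`-submodule `D.selmerSubmodule F_𝔮 _` is membership in `ordinarySelmer`.
[cite: Howard2004HeegnerKolyvagin, Def. 3.1.2] -/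
theorem mem_selmerSubmodule_eisensteinSelmerStructure_iff (h : D.H) :
    h ∈ D.selmerSubmodule (κ.eisensteinSelmerStructure ρ t hm S Φ)
        (fun k c x hx ↦ κ.map_eisensteinTwistSMulHom_mem_selmerGroup ρ t hm S Φ k c x hx) ↔
      h ∈ D.ordinarySelmer S Φ :=
  Iff.rfl

end EisensteinH1Data

/-! ## §3 `F_𝔮` is a Howard Selmer structure for `Σ = ∞ ∪ S'` -/

/-- **`F_𝔮` is unramified outside `∞ ∪ S'`** for every finite set `S'` of finite places containing `S` and the
places above `p` (tree `SelmerStructure.IsUnramifiedOutside`, Howard Def. 1.1.10) — by construction.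
[cite: Howard2004HeegnerKolyvagin, Def. 1.1.10 (arXiv Def. 2.1.10: Σ(F) ∋ archimedean places, H¹_F = H¹_unr outside)] -/
theorem isUnramifiedOutside_eisensteinSelmerStructure (k : ℕ) (S' : Finset (HeightOneSpectrum (𝓞 K)))
    (hS : S ⊆ S') (hp : ∀ v : HeightOneSpectrum (𝓞 K), ((p : ℕ) : 𝓞 K) ∈ v.asIdeal → v ∈ S') :
    (κ.eisensteinSelmerStructure ρ t hm S Φ k).IsUnramifiedOutside
      ((Finset.univ : Finset (NumberField.InfinitePlace K)).disjSum S') := by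
  refine ⟨fun w ↦ Finset.inl_mem_disjSum.2 (Finset.mem_univ w), fun v hv ↦ ?_⟩
  have hvS' : v ∉ S' := fun h ↦ hv (Finset.inr_mem_disjSum.2 h)
  exact κ.eisensteinSelmerStructure_inr_of_not_mem ρ t hm S Φ k (fun h ↦ hvS' (hp v h))
    (fun h ↦ hvS' (hS h))

end ZpExtension

/-! ### Howard's `Σ(F)` (the tree's `Howard2004.IsHowardSelmerStructure` lives in universe `0`) -/

namespace ZpExtension

variable {K : Type} [Field K] [NumberField K] {p : ℕ} [hp : Fact p.Prime] (κ : ZpExtension K p)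
  {M : ℕ → Type} [∀ k, AddCommGroup (M k)] [∀ k, TopologicalSpace (M k)] [∀ k, DiscreteTopology (M k)]
  (ρ : ∀ k, DiscreteGaloisModule K (M k))
  (t : ∀ k, (ρ (k + 1)).toContRepresentation →ⁱL (ρ k).toContRepresentation) {m : ℕ} (hm : 1 ≤ m)
  (S : Finset (HeightOneSpectrum (𝓞 K)))
  (Φ : ∀ v : HeightOneSpectrum (𝓞 K), ((p : ℕ) : 𝓞 K) ∈ v.asIdeal → OrdinaryFiltration ρ t v)

/-- **`F_𝔮` at level `k` is a Selmer structure in Howard's sense** (tree `Howard2004.IsHowardSelmerStructure`) for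
`Σ = ∞ ∪ S'`, whenever the finite set `S'` of finite places contains `S`, every place above `p`, and every finite
place at which `W_k` is ramified. [cite: Howard2004HeegnerKolyvagin, Def. 1.1.10 (arXiv Def. 2.1.10)] -/
theorem isHowardSelmerStructure_eisensteinSelmerStructure (k : ℕ) (S' : Finset (HeightOneSpectrum (𝓞 K)))
    (hS : S ⊆ S') (hp : ∀ v : HeightOneSpectrum (𝓞 K), ((p : ℕ) : 𝓞 K) ∈ v.asIdeal → v ∈ S')
    (hram : ∀ v : HeightOneSpectrum (𝓞 K), ¬ GaloisRep.IsUnramifiedAt v (κ.eisensteinTwist (ρ k) hm k) → v ∈ S') :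
    Literature.NumberTheory.GaloisCohomology.Howard2004.IsHowardSelmerStructure p
      (κ.eisensteinSelmerStructure ρ t hm S Φ k)
      ((Finset.univ : Finset (NumberField.InfinitePlace K)).disjSum S') where
  isUnramifiedOutside := κ.isUnramifiedOutside_eisensteinSelmerStructure ρ t hm S Φ k S' hS hp
  mem_of_dvd v hv := Finset.inr_mem_disjSum.2 (hp v hv)
  mem_of_ramified v hv := Finset.inr_mem_disjSum.2 (hram v hv)

end ZpExtension

end Literature.NumberTheory.EllipticCurves

end
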